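import Summits.NavierStokesRegularity.NavierStokesRegularity.Theses.AdaptedFrequency

/-!
# Route AdaptedFrequency — `TypeIGlue` (item stmt-NavierStokesRegularity-2959)

Pure logic: the four route statements `AdaptedFrequencyConverges`, `FrequencyRigidity`,
`TangentFlowTransfer`, `AdaptedKernelExists` together with the classical support
`SingularPointExists` imply `NoTypeIBlowup`.

Contrapositive chain: a Type-I solution which does not extend smoothly past `T` is maximal
(`IsMaximalSmoothSolution = classical ∧ ¬ HasSmoothExtensionPast`, definitional), so it has a
backward-singular point `x₀` (`SingularPointExists`); `AdaptedKernelExists` gives `t₀, G` adapted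
and Gaussian-comparable at `(T, x₀)`; `AdaptedFrequencyConverges` gives `Λ₀` with `Λ → Λ₀`
(the `∀ H Λ` binders instantiated by `rfl, rfl`); `TangentFlowTransfer` produces `(C, v, q, K)`
satisfying exactly the `∃`-body of `FrequencyRigidity` with `(ν, C, Λ₀)`; `FrequencyRigidity`
is `¬ ∃` of that body: contradiction.
-/

namespace Summit.NavierStokesRegularity.NavierStokesRegularity.Theorems

open Summit.NavierStokesRegularity.NavierStokesRegularity.Theses.AdaptedFrequency

/-- **TypeIGlue** (item stmt-NavierStokesRegularity-2959, route AdaptedFrequency): the route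
statements `AdaptedFrequencyConverges`, `FrequencyRigidity`, `TangentFlowTransfer`,
`AdaptedKernelExists` and `SingularPointExists` imply `NoTypeIBlowup` — pure logic, by the
contrapositive chain maximal ⇒ backward-singular point ⇒ adapted comparable kernel ⇒ convergent
adapted frequency ⇒ tangent flow with constant adapted frequency ⇒ excluded by rigidity. -/
theorem adaptedFrequency_typeIGlue_proof : TypeIGlue := by
  unfold TypeIGlue
  intro hAFC hFR hTFT hAKE hSPE ν T hν hT u p hcl hLH hdec hTI
  by_contra hne
  have hmax : Literature.Analysis.FluidPDE.IsMaximalSmoothSolution ν 0 u p T := ⟨hcl, hne⟩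
  obtain ⟨x₀, hsing⟩ := hSPE ν T hν hT u p hmax hLH hdec
  obtain ⟨t₀, ht₀, G, hK, hcomp⟩ := hAKE ν T hν hT u p hcl hLH hdec hTI x₀
  obtain ⟨Λ₀, hlim⟩ := hAFC ν T hν hT u p hcl hLH hdec hTI x₀ t₀ G ht₀ hsing hK hcomp _ _ rfl rfl
  obtain ⟨C, v, q, K, hbody⟩ :=
    hTFT ν T hν hT u p hcl hLH hdec hTI x₀ t₀ G ht₀ hsing hK hcomp _ _ rfl rfl Λ₀ hlim
  exact hFR ⟨ν, C, Λ₀, v, q, K, hν, hbody⟩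

end Summit.NavierStokesRegularity.NavierStokesRegularity.Theorems
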